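import Mathlib
import HarnessLib
import Summits.NavierStokesRegularity.NavierStokesRegularity.Theorems.PoloidalWindowDoorPoloidalWindowRigidityLoopTangencyPin
import Summits.NavierStokesRegularity.NavierStokesRegularity.Theorems.PoloidalWindowDoorPoloidalWindowRigidityThreadZeroStructure

/-!
# Route `PoloidalWindowDoor`, crux `PoloidalWindowRigidity` (K2, stmt-NavierStokesRegularity-19708) — the thread pins
# P1 and Z1 under the WEAKER hypothesis «strict hot spot» (no curve selection needed upstream)

Cell ns-regularity-ideate, seat ns-poloidal-K2-p2 g11 (stub-worker on K2; `--supports` the crux item).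

OBSERVATION for the planners of lines `isolated_thread` / `thread_type` / `centre_type` (ns-idea-8): the proofs of
P1 `stub_loopTangencyPin` (`…LoopTangencyPin`) and of Z1 `stub_threadZeroStructure` (`…ThreadZeroStructure`) use the
isolation hypothesis `hiso` («no horizontal critical point of `v₂(−1,·)` in a punctured δ-ball of the plane») ONLY
through its consequence «no point `y ≠ 0` of the punctured planar δ-ball has `v₂(−1,y) = v₂(−1,0)`» — a STRICT hot spot
(every such point is a global extremum of `v₂(−1,·)`, hence critical).  This file lands both pins under that weaker
hypothesis.  Consequence for the skeletons: the curve-selection stub I1 `stub_threadCurveSelection` (Milnor–Łojasiewicz,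
Mathlib-absent, L-sized) can be replaced by EXCLUDED MIDDLE on strictness — «strict hot spot» (this file's world, where
P1/Z1 hold) versus «the hot level set `{y : y₂ = 0, v₂(−1,y) = v₂(−1,0)}` accumulates at the thread» (the arc residue
I3's world, with the arc weakened to an accumulating hot level set; the arc form is recovered from analyticity on
paper, not needed in the composition).

* `strictHotSpot_of_isolated` — `hiso ⇒ hstrict` (so the strict versions imply the landed ones);
* `loopTangencyPin_of_strict` — P1 with `hstrict` in place of `hiso`;
* `det_hessian_sub_shear_nonneg_of_strict` — Z1 part B with `hstrict`;
* `threadZeroStructure_of_strict` — Z1 (A ∧ B ∧ C) with `hstrict`.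

WHAT THIS IS NOT: not a claim about Navier–Stokes regularity, not K2/I2 — kinematics of HYPOTHETICAL poloidal Type-I
blow-up profiles; a hypothesis-weakening of two landed helper stubs, offered to the planners as a re-cut option
(bears_on LADDER-NS N0, rung N0-LocalTubeDoorPoloidal).
-/

noncomputable section

-- the summit and its single sub-problem share the name (CONVENTIONS §1), as in every Theorems file
set_option linter.dupNamespace false

namespace Summit.NavierStokesRegularity.NavierStokesRegularity.Theorems.PoloidalWindowDoorPoloidalWindowRigidityThreadStrictHotSpot

open MeasureTheory Set Function Filter Topology Metric
open scoped RealInnerProductSpace InnerProductSpace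
open Literature.Analysis Literature.Analysis.FluidPDE
open Summit.NavierStokesRegularity.NavierStokesRegularity.Theorems.PoloidalWindowDoorPoloidalWindowRigidityConstantShearMeans
open Summit.NavierStokesRegularity.NavierStokesRegularity.Theorems.PoloidalWindowDoorPoloidalWindowRigidityWindow
open Summit.NavierStokesRegularity.NavierStokesRegularity.Theorems.PoloidalWindowDoorPoloidalWindowRigidityFirstIntegral
open Summit.NavierStokesRegularity.NavierStokesRegularity.Theorems.PoloidalWindowDoorLrcModEntireMorseLevelRays
open Summit.NavierStokesRegularity.NavierStokesRegularity.Theorems.PoloidalWindowDoorPoloidalWindowRigidityLoopTangencyPin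
open Summit.NavierStokesRegularity.NavierStokesRegularity.Theorems.PoloidalWindowDoorPoloidalWindowRigidityThreadShearHessian
open Summit.NavierStokesRegularity.NavierStokesRegularity.Theorems.PoloidalWindowDoorPoloidalWindowRigidityThreadNoXPoint
open Summit.NavierStokesRegularity.NavierStokesRegularity.Theorems.PoloidalWindowDoorPoloidalWindowRigidityThreadCentreExtremum
open Summit.NavierStokesRegularity.NavierStokesRegularity.Theorems.PoloidalWindowDoorPoloidalWindowRigidityThreadZeroStructure

variable {C : ℝ} {v : ℝ → EuclideanSpace ℝ (Fin 3) → EuclideanSpace ℝ (Fin 3)}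

/-- **Isolated ⇒ strict.**  Under the hot-spot normalisation `√(−t)|v₂| ≤ |v₂(−1,0)|`, if no point `y ≠ 0` of a
punctured planar δ-ball is a horizontal critical point of `v₂(−1,·)`, then no such point carries the value
`v₂(−1,0)` (a point with that value is a global extremum of `v₂(−1,·)`, hence critical). -/
theorem strictHotSpot_of_isolated
    (hsup : ∀ t < 0, ∀ x, Real.sqrt (-t) * |v t x 2| ≤ |v (-1) 0 2|) {δ : ℝ}
    (hiso : ∀ y : EuclideanSpace ℝ (Fin 3), y 2 = 0 → y ≠ 0 → ‖y‖ < δ →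
      (fderiv ℝ (v (-1)) y (EuclideanSpace.single 0 1) 2 ≠ 0 ∨
        fderiv ℝ (v (-1)) y (EuclideanSpace.single 1 1) 2 ≠ 0))
    (hvd : Differentiable ℝ (v (-1))) :
    ∀ y : EuclideanSpace ℝ (Fin 3), y 2 = 0 → y ≠ 0 → ‖y‖ < δ → v (-1) y 2 ≠ v (-1) 0 2 := by
  intro y hy2 hy0 hyδ hval
  have hle : ∀ z, |(fun z => v (-1) z 2) z| ≤ |(fun z => v (-1) z 2) y| := fun z => by
    simp only [hval]
    simpa using hsup (-1) (by norm_num) z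
  have h0 := fderiv_eq_zero_of_abs_le hle
  have hcomp : ∀ h, fderiv ℝ (v (-1)) y h 2 = 0 := fun h => by
    rw [← fderiv_apply_coord_vec3 (hvd y) 2 h, h0]
    simp
  rcases hiso y hy2 hy0 hyδ with h | h
  · exact h (hcomp _)
  · exact h (hcomp _)

/-- **P1 under the strict-hot-spot hypothesis**: `∂_z v₀(−1,0) = ∂_z v₁(−1,0) = 0` for a poloidal class profile
whose hot spot at `(−1,0)` is STRICT along the plane (`v₂(−1,y) ≠ v₂(−1,0)` for horizontal `0 < ‖y‖ < δ`).  Same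
proof as `…LoopTangencyPin.stub_loopTangencyPin`; the integral curve of `curl v(−1,·)` through the hot spot carries
the hot value, contradicting strictness directly. -/
theorem loopTangencyPin_of_strict (hrate : HasTypeITimeDecay C v)
    (hcont : ContinuousOn (uncurry v) (Iio (0 : ℝ) ×ˢ univ))
    (hmild : ∀ s t : ℝ, s < t → t < 0 → ∀ x,
      v t x = UnboundedOperators.heatExtension (v s) (t - s) x - oseenDuhamel 1 s v v t x)
    (hdiv : ∀ t < 0, VectorCalculus.IsDivFree (v t))
    (hpol : ∀ s < 0, ∀ y, ⟪curl (v s) y, EuclideanSpace.single 2 1⟫_ℝ = 0)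
    (hsup : ∀ t < 0, ∀ x, Real.sqrt (-t) * |v t x 2| ≤ |v (-1) 0 2|)
    (hstrict : ∃ δ : ℝ, 0 < δ ∧ ∀ y : EuclideanSpace ℝ (Fin 3), y 2 = 0 → y ≠ 0 → ‖y‖ < δ →
      v (-1) y 2 ≠ v (-1) 0 2) :
    fderiv ℝ (v (-1)) 0 (EuclideanSpace.single 2 1) 0 = 0 ∧
      fderiv ℝ (v (-1)) 0 (EuclideanSpace.single 2 1) 1 = 0 := by
  obtain ⟨δ, hδ, hstrict⟩ := hstrict
  -- smoothness of the slice `v(-1)` and of its curl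
  have hA : IsTypeIAncientMild C v := isTypeIAncientMild_of_class hrate hcont hmild hdiv
  have hvs : ContDiff ℝ (⊤ : ℕ∞) (v (-1)) := hA.contDiff_slice (by norm_num)
  have hv2 : ContDiff ℝ 2 (v (-1)) := contDiff_infty.1 hvs 2
  have hω1 : ContDiff ℝ 1 (curl (v (-1))) := contDiff_curl (n := 1) (by exact_mod_cast hv2)
  have hvd : Differentiable ℝ (v (-1)) := hv2.differentiable two_ne_zero
  -- the hot-spot normalisation at `t = -1`: `|v₂(-1,y)| ≤ |v₂(-1,0)|`
  have hext : ∀ y, |v (-1) y 2| ≤ |v (-1) 0 2| := fun y => by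
    have h := hsup (-1) (by norm_num) y
    simpa using h
  -- the frozen law at `s = -1`: `(Dv(-1,y) ω(-1,y))₂ = 0`
  have hfrozen : ∀ y, fderiv ℝ (v (-1)) y (curl (v (-1)) y) 2 = 0 := fun y => by
    have h := stub_firstIntegral C v hrate hcont hmild hdiv (EuclideanSpace.single 2 1) hpol (-1)
      (by norm_num) y
    simpa [EuclideanSpace.inner_single_right] using h
  -- poloidality at `s = -1`: `ω₂(-1,y) = 0`
  have hpol1 : ∀ y, curl (v (-1)) y 2 = 0 := fun y => by
    have h := hpol (-1) (by norm_num) y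
    simpa [EuclideanSpace.inner_single_right] using h
  -- Fermat: the gradient of `v₂(-1,·)` vanishes wherever `|v₂(-1,·)|` is maximal
  have hgrad : ∀ y, |v (-1) y 2| = |v (-1) 0 2| →
      ∀ h : EuclideanSpace ℝ (Fin 3), fderiv ℝ (v (-1)) y h 2 = 0 := by
    intro y hy h
    have hle : ∀ z, |(fun z => v (-1) z 2) z| ≤ |(fun z => v (-1) z 2) y| := fun z => by
      simp only [hy]
      exact hext z
    have h0 := fderiv_eq_zero_of_abs_le hle
    rw [← fderiv_apply_coord_vec3 (hvd y) 2 h, h0]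
    simp
  -- MAIN CLAIM: the vorticity vanishes at the hot spot
  have hcurl0 : curl (v (-1)) 0 = 0 := by
    by_contra hne
    -- the integral curve of `curl v(-1,·)` through `0`
    obtain ⟨c, hc0, ε, hε, hc⟩ :=
      (hω1.contDiffAt (x := (0 : EuclideanSpace ℝ (Fin 3)))).exists_forall_mem_closedBall_exists_eq_forall_mem_Ioo_hasDerivAt₀ 0
    have hc' : ∀ t ∈ Ioo (-ε) ε, HasDerivAt c (curl (v (-1)) (c t)) t := fun t ht =>
      hc t (by simpa using ht)
    have h0ε : (0 : ℝ) ∈ Ioo (-ε) ε := ⟨by linarith, hε⟩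
    -- the curve stays in the plane `{y₂ = 0}`
    have hc2 : ∀ t ∈ Ioo (-ε) ε, c t 2 = 0 := fun t ht => by
      have hφ : Differentiable ℝ (⇑(EuclideanSpace.proj (𝕜 := ℝ) (2 : Fin 3))) :=
        (EuclideanSpace.proj (𝕜 := ℝ) (2 : Fin 3)).differentiable
      have hφX : ∀ y, fderiv ℝ (⇑(EuclideanSpace.proj (𝕜 := ℝ) (2 : Fin 3))) y (curl (v (-1)) y) = 0 :=
        fun y => by
          rw [(EuclideanSpace.proj (𝕜 := ℝ) (2 : Fin 3)).fderiv]
          simpa using hpol1 y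
      have h := apply_integralCurve_eq hc' hφ hφX ht
      rw [hc0] at h
      simpa using h
    -- `v₂(-1,·)` is constant along the curve
    have hcv : ∀ t ∈ Ioo (-ε) ε, v (-1) (c t) 2 = v (-1) 0 2 := fun t ht => by
      have hφ : Differentiable ℝ (fun y => v (-1) y 2) :=
        (contDiff_apply_coord_vec3 hv2 2).differentiable two_ne_zero
      have hφX : ∀ y, fderiv ℝ (fun y => v (-1) y 2) y (curl (v (-1)) y) = 0 := fun y => by
        rw [fderiv_apply_coord_vec3 (hvd y) 2]
        exact hfrozen y
      have h := apply_integralCurve_eq hc' hφ hφX ht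
      rwa [hc0] at h
    -- for small `t ≠ 0`: `c t ≠ 0`, `‖c t‖ < δ`, `t ∈ Ioo (-ε) ε`
    have h1 : ∀ᶠ t in 𝓝[≠] (0 : ℝ), c t ≠ 0 :=
      (hc' 0 h0ε).eventually_ne (by rw [hc0]; exact hne)
    have h2 : ∀ᶠ t in 𝓝 (0 : ℝ), ‖c t‖ < δ := by
      have hca : ContinuousAt c 0 := (hc' 0 h0ε).continuousAt
      have h : ∀ᶠ t in 𝓝 (0 : ℝ), c t ∈ ball (0 : EuclideanSpace ℝ (Fin 3)) δ :=
        hca.preimage_mem_nhds (by rw [hc0]; exact ball_mem_nhds _ hδ)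
      filter_upwards [h] with t ht
      simpa using ht
    have h3 : ∀ᶠ t in 𝓝 (0 : ℝ), t ∈ Ioo (-ε) ε := Ioo_mem_nhds (by linarith) hε
    obtain ⟨t, ht1, ht2, ht3⟩ := (h1.and ((h2.and h3).filter_mono nhdsWithin_le_nhds)).exists
    -- the curve point `c t` is a horizontal critical point in the punctured `δ`-ball: contradiction
    exact hstrict (c t) (hc2 t ht3) ht1 ht2 (hcv t ht3)
  -- conclusion: `ω₀(-1,0) = ω₁(-1,0) = 0` and `∇v₂(-1,0) = 0` give the two shear pins
  have hg0 : ∀ h : EuclideanSpace ℝ (Fin 3), fderiv ℝ (v (-1)) 0 h 2 = 0 := hgrad 0 rfl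
  have e0 : fderiv ℝ (v (-1)) 0 (EuclideanSpace.single 1 1) 2 =
      fderiv ℝ (v (-1)) 0 (EuclideanSpace.single 2 1) 1 := by
    have h : curl (v (-1)) 0 0 = 0 := by simp [hcurl0]
    simpa [curl, sub_eq_zero] using h
  have e1 : fderiv ℝ (v (-1)) 0 (EuclideanSpace.single 2 1) 0 =
      fderiv ℝ (v (-1)) 0 (EuclideanSpace.single 0 1) 2 := by
    have h : curl (v (-1)) 0 1 = 0 := by simp [hcurl0]
    simpa [curl, sub_eq_zero] using h
  refine ⟨?_, ?_⟩
  · rw [e1]; exact hg0 _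
  · rw [← e0]; exact hg0 _


/-- **Z1 part B under the strict-hot-spot hypothesis**: `det(H − M) ≥ 0`.  Same proof as
`…ThreadZeroStructure.det_hessian_sub_shear_nonneg`; the level point produced by the no-X-point lemma contradicts
strictness directly. -/
theorem det_hessian_sub_shear_nonneg_of_strict {C : ℝ} {v : ℝ → EuclideanSpace ℝ (Fin 3) → EuclideanSpace ℝ (Fin 3)}
    (hrate : HasTypeITimeDecay C v)
    (hcont : ContinuousOn (uncurry v) (Iio (0 : ℝ) ×ˢ univ))
    (hmild : ∀ s t : ℝ, s < t → t < 0 → ∀ x,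
      v t x = UnboundedOperators.heatExtension (v s) (t - s) x - oseenDuhamel 1 s v v t x)
    (hdiv : ∀ t < 0, VectorCalculus.IsDivFree (v t))
    (hpol : ∀ s < 0, ∀ y, ⟪curl (v s) y, EuclideanSpace.single 2 1⟫_ℝ = 0)
    (hgrad : ∀ h : EuclideanSpace ℝ (Fin 3), fderiv ℝ (v (-1)) 0 h 2 = 0)
    (hstrict : ∃ δ : ℝ, 0 < δ ∧ ∀ y : EuclideanSpace ℝ (Fin 3), y 2 = 0 → y ≠ 0 → ‖y‖ < δ →
      v (-1) y 2 ≠ v (-1) 0 2)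
    (hpin : fderiv ℝ (v (-1)) 0 (EuclideanSpace.single 2 1) 0 = 0 ∧
      fderiv ℝ (v (-1)) 0 (EuclideanSpace.single 2 1) 1 = 0) :
    0 ≤ (fderiv ℝ (fun x => fderiv ℝ (v (-1)) x (EuclideanSpace.single 0 1) 2) 0 (EuclideanSpace.single 0 1) -
            fderiv ℝ (fun x => fderiv ℝ (v (-1)) x (EuclideanSpace.single 2 1) 0) 0 (EuclideanSpace.single 0 1)) *
          (fderiv ℝ (fun x => fderiv ℝ (v (-1)) x (EuclideanSpace.single 1 1) 2) 0 (EuclideanSpace.single 1 1) -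
            fderiv ℝ (fun x => fderiv ℝ (v (-1)) x (EuclideanSpace.single 2 1) 1) 0 (EuclideanSpace.single 1 1)) -
          (fderiv ℝ (fun x => fderiv ℝ (v (-1)) x (EuclideanSpace.single 0 1) 2) 0 (EuclideanSpace.single 1 1) -
            fderiv ℝ (fun x => fderiv ℝ (v (-1)) x (EuclideanSpace.single 2 1) 0) 0 (EuclideanSpace.single 1 1)) *
          (fderiv ℝ (fun x => fderiv ℝ (v (-1)) x (EuclideanSpace.single 1 1) 2) 0 (EuclideanSpace.single 0 1) -
            fderiv ℝ (fun x => fderiv ℝ (v (-1)) x (EuclideanSpace.single 2 1) 1) 0 (EuclideanSpace.single 0 1)) := by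
  obtain ⟨δ, hδ, hstrict⟩ := hstrict
  have hA : IsTypeIAncientMild C v := isTypeIAncientMild_of_class hrate hcont hmild hdiv
  have hvs : ContDiff ℝ (⊤ : ℕ∞) (v (-1)) := hA.contDiff_slice (by norm_num)
  have hV2 : ContDiff ℝ 2 (v (-1)) := contDiff_infty.1 hvs 2
  have hVd : Differentiable ℝ (v (-1)) := hV2.differentiable two_ne_zero
  obtain ⟨φ, ψ, -, hψ2, -, -, hbr0, hψ0, hS0, hS1⟩ :=
    clebsch_thread_package hrate hcont hmild hdiv hpol hgrad hpin
  -- the scalar `f = v₂(−1,·)`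
  set f : EuclideanSpace ℝ (Fin 3) → ℝ := fun y => v (-1) y 2 with hf
  have hf1 : ContDiff ℝ 1 f := (contDiff_coord hV2 2).of_le (by norm_num)
  have hfq : ∀ y w, fderiv ℝ f y w = fderiv ℝ (v (-1)) y w 2 := fun y w => fderiv_coord_apply (hVd y) 2 w
  -- pass to the Hessian entries of `ψ`
  rw [← hS0, ← hS0, ← hS1, ← hS1]
  have hsym : fderiv ℝ (fun y => fderiv ℝ ψ y (EuclideanSpace.single 0 1)) 0 (EuclideanSpace.single 1 1) =
      fderiv ℝ (fun y => fderiv ℝ ψ y (EuclideanSpace.single 1 1)) 0 (EuclideanSpace.single 0 1) :=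
    fderiv_fderiv_symm hψ2 0 _ _
  -- bilinear expansion of the Hessian along horizontal vectors
  have hdψ : ∀ a : Fin 3, Differentiable ℝ fun y => fderiv ℝ ψ y (EuclideanSpace.single a 1) :=
    fun a => (contDiff_fderiv_apply_const hψ2 _).differentiable one_ne_zero
  have hHess : ∀ w₀ w₁ d₀ d₁ : ℝ,
      fderiv ℝ (fun y => fderiv ℝ ψ y (w₀ • EuclideanSpace.single 0 1 + w₁ • EuclideanSpace.single 1 1)) 0
          (d₀ • EuclideanSpace.single 0 1 + d₁ • EuclideanSpace.single 1 1) =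
        w₀ * (d₀ * fderiv ℝ (fun y => fderiv ℝ ψ y (EuclideanSpace.single 0 1)) 0 (EuclideanSpace.single 0 1) +
            d₁ * fderiv ℝ (fun y => fderiv ℝ ψ y (EuclideanSpace.single 0 1)) 0 (EuclideanSpace.single 1 1)) +
          w₁ * (d₀ * fderiv ℝ (fun y => fderiv ℝ ψ y (EuclideanSpace.single 1 1)) 0 (EuclideanSpace.single 0 1) +
            d₁ * fderiv ℝ (fun y => fderiv ℝ ψ y (EuclideanSpace.single 1 1)) 0 (EuclideanSpace.single 1 1)) := by
    intro w₀ w₁ d₀ d₁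
    have hfun : (fun y => fderiv ℝ ψ y (w₀ • EuclideanSpace.single 0 1 + w₁ • EuclideanSpace.single 1 1)) =
        fun y => w₀ * fderiv ℝ ψ y (EuclideanSpace.single 0 1) + w₁ * fderiv ℝ ψ y (EuclideanSpace.single 1 1) := by
      funext y
      rw [map_add, map_smul, map_smul, smul_eq_mul, smul_eq_mul]
    have hd0 : DifferentiableAt ℝ (fun y => w₀ * fderiv ℝ ψ y (EuclideanSpace.single 0 1)) 0 :=
      ((hdψ 0) 0).const_mul w₀
    have hd1 : DifferentiableAt ℝ (fun y => w₁ * fderiv ℝ ψ y (EuclideanSpace.single 1 1)) 0 :=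
      ((hdψ 1) 0).const_mul w₁
    rw [hfun, fderiv_fun_add hd0 hd1, _root_.add_apply, fderiv_const_mul ((hdψ 0) 0) w₀,
      fderiv_const_mul ((hdψ 1) 0) w₁]
    simp only [FunLike.coe_smul, Pi.smul_apply, smul_eq_mul, map_add, map_smul]
    ring
  -- the bracket along horizontal frames
  have hbrE : ∀ (t u n₀ n₁ : ℝ) (y : EuclideanSpace ℝ (Fin 3)),
      fderiv ℝ ψ y (t • EuclideanSpace.single 0 1 + u • EuclideanSpace.single 1 1) *
          fderiv ℝ f y (n₀ • EuclideanSpace.single 0 1 + n₁ • EuclideanSpace.single 1 1) -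
        fderiv ℝ ψ y (n₀ • EuclideanSpace.single 0 1 + n₁ • EuclideanSpace.single 1 1) *
          fderiv ℝ f y (t • EuclideanSpace.single 0 1 + u • EuclideanSpace.single 1 1) = 0 := by
    intro t u n₀ n₁ y
    simp only [map_add, map_smul, smul_eq_mul]
    simp only [hfq]
    linear_combination (u * n₀ - t * n₁) * hbr0 y
  -- name the Hessian entries
  generalize hp : fderiv ℝ (fun y => fderiv ℝ ψ y (EuclideanSpace.single 0 1)) 0 (EuclideanSpace.single 0 1) = p
    at hHess ⊢
  generalize hq : fderiv ℝ (fun y => fderiv ℝ ψ y (EuclideanSpace.single 0 1)) 0 (EuclideanSpace.single 1 1) = q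
    at hHess hsym ⊢
  generalize hq' : fderiv ℝ (fun y => fderiv ℝ ψ y (EuclideanSpace.single 1 1)) 0 (EuclideanSpace.single 0 1) = q'
    at hHess hsym ⊢
  generalize hr : fderiv ℝ (fun y => fderiv ℝ ψ y (EuclideanSpace.single 1 1)) 0 (EuclideanSpace.single 1 1) = r
    at hHess ⊢
  subst hsym
  -- suppose the Hessian were indefinite
  by_contra hneg
  rw [not_le] at hneg
  -- an isotropic pair `(t, u) ≠ 0`
  obtain ⟨t, u, htu, hQ⟩ : ∃ t u : ℝ, (t ≠ 0 ∨ u ≠ 0) ∧ p * t ^ 2 + 2 * q * t * u + r * u ^ 2 = 0 := by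
    by_cases hp0 : p = 0
    · exact ⟨1, 0, Or.inl one_ne_zero, by simp [hp0]⟩
    · set s := Real.sqrt (q ^ 2 - p * r) with hs_def
      have hs : s ^ 2 = q ^ 2 - p * r := Real.sq_sqrt (by nlinarith)
      refine ⟨(-q + s) / p, 1, Or.inr one_ne_zero, ?_⟩
      have hpt : p * ((-q + s) / p) = -q + s := by field_simp
      have key : p * (p * ((-q + s) / p) ^ 2 + 2 * q * ((-q + s) / p) * 1 + r * 1 ^ 2) = 0 := by
        have h1 : p * (p * ((-q + s) / p) ^ 2 + 2 * q * ((-q + s) / p) * 1 + r * 1 ^ 2) =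
            (p * ((-q + s) / p)) ^ 2 + 2 * q * (p * ((-q + s) / p)) + p * r := by ring
        rw [h1, hpt]
        linear_combination hs
      exact (mul_eq_zero.1 key).resolve_left hp0
  -- the transversal direction `n = (H − M)e`
  set n₀ : ℝ := p * t + q * u with hn₀
  set n₁ : ℝ := q * t + r * u with hn₁
  have hc : 0 < n₀ ^ 2 + n₁ ^ 2 := by
    rcases (add_nonneg (sq_nonneg n₀) (sq_nonneg n₁)).lt_or_eq with h | h
    · exact h
    · exfalso
      have h0 : n₀ = 0 := by nlinarith [sq_nonneg n₀, sq_nonneg n₁]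
      have h1 : n₁ = 0 := by nlinarith [sq_nonneg n₀, sq_nonneg n₁]
      have ht : (p * r - q * q) * t = 0 := by
        have : (p * r - q * q) * t = r * n₀ - q * n₁ := by rw [hn₀, hn₁]; ring
        rw [this, h0, h1]; ring
      have hu : (p * r - q * q) * u = 0 := by
        have : (p * r - q * q) * u = p * n₁ - q * n₀ := by rw [hn₀, hn₁]; ring
        rw [this, h0, h1]; ring
      have hne : p * r - q * q ≠ 0 := hneg.ne
      rcases htu with h' | h'
      · exact h' ((mul_eq_zero.1 ht).resolve_left hne)
      · exact h' ((mul_eq_zero.1 hu).resolve_left hne)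
  set e : EuclideanSpace ℝ (Fin 3) := t • EuclideanSpace.single 0 1 + u • EuclideanSpace.single 1 1 with he
  set n : EuclideanSpace ℝ (Fin 3) := n₀ • EuclideanSpace.single 0 1 + n₁ • EuclideanSpace.single 1 1 with hn
  -- hypotheses of the no-X-point lemma
  have he0 : fderiv ℝ ψ 0 e = 0 := hψ0 t u
  have hn0 : fderiv ℝ ψ 0 n = 0 := hψ0 n₀ n₁
  have hee : fderiv ℝ (fun y => fderiv ℝ ψ y e) 0 e = 0 := by
    rw [he, hHess t u t u]
    linear_combination hQ
  have hne : 0 < fderiv ℝ (fun y => fderiv ℝ ψ y n) 0 e := by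
    rw [hn, he, hHess n₀ n₁ t u]
    have h1 : n₀ * (t * p + u * q) + n₁ * (t * q + u * r) = n₀ ^ 2 + n₁ ^ 2 := by rw [hn₀, hn₁]; ring
    rw [h1]
    exact hc
  have hbr : ∀ y, fderiv ℝ ψ y e * fderiv ℝ f y n - fderiv ℝ ψ y n * fderiv ℝ f y e = 0 := fun y =>
    hbrE t u n₀ n₁ y
  -- the level point near the thread
  obtain ⟨a, b, hy0, hyδ, hfy⟩ := exists_levelPoint_near hψ2 hf1 hbr he0 hn0 hee hne hδ
  have hy2 : (a • e + b • n) 2 = 0 := by simp [he, hn]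
  exact hstrict (a • e + b • n) hy2 hy0 hyδ (by simpa [hf] using hfy)


/-- **Z1 (A ∧ B ∧ C) under the strict-hot-spot hypothesis** — the conclusion of `stub_threadZeroStructure` VERBATIM,
with `hiso` replaced by strictness of the hot spot along the plane (and the unused `N ≠ 0` dropped). -/
theorem threadZeroStructure_of_strict (hrate : HasTypeITimeDecay C v)
    (hcont : ContinuousOn (uncurry v) (Iio (0 : ℝ) ×ˢ univ))
    (hmild : ∀ s t : ℝ, s < t → t < 0 → ∀ x,
      v t x = UnboundedOperators.heatExtension (v s) (t - s) x - oseenDuhamel 1 s v v t x)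
    (hdiv : ∀ t < 0, VectorCalculus.IsDivFree (v t))
    (hpol : ∀ s < 0, ∀ y, ⟪curl (v s) y, EuclideanSpace.single 2 1⟫_ℝ = 0)
    (hgrad : ∀ h : EuclideanSpace ℝ (Fin 3), fderiv ℝ (v (-1)) 0 h 2 = 0)
    (hstrict : ∃ δ : ℝ, 0 < δ ∧ ∀ y : EuclideanSpace ℝ (Fin 3), y 2 = 0 → y ≠ 0 → ‖y‖ < δ →
      v (-1) y 2 ≠ v (-1) 0 2)
    (hpin : fderiv ℝ (v (-1)) 0 (EuclideanSpace.single 2 1) 0 = 0 ∧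
      fderiv ℝ (v (-1)) 0 (EuclideanSpace.single 2 1) 1 = 0) :
      (fderiv ℝ (fun x => fderiv ℝ (v (-1)) x (EuclideanSpace.single 2 1) 0) 0 (EuclideanSpace.single 1 1) =
            fderiv ℝ (fun x => fderiv ℝ (v (-1)) x (EuclideanSpace.single 2 1) 1) 0 (EuclideanSpace.single 0 1) ∧
          fderiv ℝ (fun x => fderiv ℝ (v (-1)) x (EuclideanSpace.single 2 1) 0) 0 (EuclideanSpace.single 0 1) +
              fderiv ℝ (fun x => fderiv ℝ (v (-1)) x (EuclideanSpace.single 2 1) 1) 0 (EuclideanSpace.single 1 1) =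
            -fderiv ℝ (fun x => fderiv ℝ (v (-1)) x (EuclideanSpace.single 2 1) 2) 0 (EuclideanSpace.single 2 1)) ∧
        ((∃ c₁ c₂ : ℝ, (c₁ ≠ 0 ∨ c₂ ≠ 0) ∧ ∀ a b : Fin 3, a ≠ 2 → b ≠ 2 →
            c₁ * fderiv ℝ (fun x => fderiv ℝ (v (-1)) x (EuclideanSpace.single 2 1) a) 0 (EuclideanSpace.single b 1) =
              c₂ * fderiv ℝ (fun x => fderiv ℝ (v (-1)) x (EuclideanSpace.single a 1) 2) 0 (EuclideanSpace.single b 1))) ∧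
        0 ≤ (fderiv ℝ (fun x => fderiv ℝ (v (-1)) x (EuclideanSpace.single 0 1) 2) 0 (EuclideanSpace.single 0 1) -
            fderiv ℝ (fun x => fderiv ℝ (v (-1)) x (EuclideanSpace.single 2 1) 0) 0 (EuclideanSpace.single 0 1)) *
          (fderiv ℝ (fun x => fderiv ℝ (v (-1)) x (EuclideanSpace.single 1 1) 2) 0 (EuclideanSpace.single 1 1) -
            fderiv ℝ (fun x => fderiv ℝ (v (-1)) x (EuclideanSpace.single 2 1) 1) 0 (EuclideanSpace.single 1 1)) -
          (fderiv ℝ (fun x => fderiv ℝ (v (-1)) x (EuclideanSpace.single 0 1) 2) 0 (EuclideanSpace.single 1 1) -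
            fderiv ℝ (fun x => fderiv ℝ (v (-1)) x (EuclideanSpace.single 2 1) 0) 0 (EuclideanSpace.single 1 1)) *
          (fderiv ℝ (fun x => fderiv ℝ (v (-1)) x (EuclideanSpace.single 1 1) 2) 0 (EuclideanSpace.single 0 1) -
            fderiv ℝ (fun x => fderiv ℝ (v (-1)) x (EuclideanSpace.single 2 1) 1) 0 (EuclideanSpace.single 0 1)) ∧
        (0 < (fderiv ℝ (fun x => fderiv ℝ (v (-1)) x (EuclideanSpace.single 0 1) 2) 0 (EuclideanSpace.single 0 1) -
            fderiv ℝ (fun x => fderiv ℝ (v (-1)) x (EuclideanSpace.single 2 1) 0) 0 (EuclideanSpace.single 0 1)) *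
          (fderiv ℝ (fun x => fderiv ℝ (v (-1)) x (EuclideanSpace.single 1 1) 2) 0 (EuclideanSpace.single 1 1) -
            fderiv ℝ (fun x => fderiv ℝ (v (-1)) x (EuclideanSpace.single 2 1) 1) 0 (EuclideanSpace.single 1 1)) -
          (fderiv ℝ (fun x => fderiv ℝ (v (-1)) x (EuclideanSpace.single 0 1) 2) 0 (EuclideanSpace.single 1 1) -
            fderiv ℝ (fun x => fderiv ℝ (v (-1)) x (EuclideanSpace.single 2 1) 0) 0 (EuclideanSpace.single 1 1)) *
          (fderiv ℝ (fun x => fderiv ℝ (v (-1)) x (EuclideanSpace.single 1 1) 2) 0 (EuclideanSpace.single 0 1) -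
            fderiv ℝ (fun x => fderiv ℝ (v (-1)) x (EuclideanSpace.single 2 1) 1) 0 (EuclideanSpace.single 0 1)) →
          ∃ Φ : EuclideanSpace ℝ (Fin 3) → ℝ, ContDiff ℝ 2 Φ ∧
            (∀ y, v (-1) y 0 = fderiv ℝ Φ y (EuclideanSpace.single 0 1) ∧
              v (-1) y 1 = fderiv ℝ Φ y (EuclideanSpace.single 1 1)) ∧
            ((∀ᶠ y in nhdsWithin (0 : EuclideanSpace ℝ (Fin 3)) {y | y 2 = (0 : EuclideanSpace ℝ (Fin 3)) 2 ∧ y ≠ 0},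
                v (-1) 0 2 - fderiv ℝ Φ 0 (EuclideanSpace.single 2 1) <
                  v (-1) y 2 - fderiv ℝ Φ y (EuclideanSpace.single 2 1)) ∨
              (∀ᶠ y in nhdsWithin (0 : EuclideanSpace ℝ (Fin 3)) {y | y 2 = (0 : EuclideanSpace ℝ (Fin 3)) 2 ∧ y ≠ 0},
                v (-1) y 2 - fderiv ℝ Φ y (EuclideanSpace.single 2 1) <
                  v (-1) 0 2 - fderiv ℝ Φ 0 (EuclideanSpace.single 2 1)))) := by
  obtain ⟨hA12, hA3⟩ := threadZeroStructure_partA hrate hcont hmild hdiv hpol hgrad hpin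
  exact ⟨hA12, hA3, det_hessian_sub_shear_nonneg_of_strict hrate hcont hmild hdiv hpol hgrad hstrict hpin,
    fun hdet => centre_strictExtremum hrate hcont hmild hdiv hpol hgrad hpin hdet⟩

end Summit.NavierStokesRegularity.NavierStokesRegularity.Theorems.PoloidalWindowDoorPoloidalWindowRigidityThreadStrictHotSpot

end
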